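import Summits.QuantumFields.BalabanUV.T4Continuum.Spine.NE7.QLaCriticality

/-!
# Spine/NE7/QLaYoungEntries — (QL-a) WHEN NODE S IS SILENT ON THE YOUNGEST AGES: the contracting per-entry bound only for entries of
# age `≥ n₁`, the TRIVIAL bound `|c_t − c_0| ≤ 4|t|` (rider range `≤ 2`) for all entries, a weighted census AND a plain COUNT census
# ⟹ `Spine.NE7.QLa` with the SAME ratio `a = θ²Λ` and the size constant inflated by the `K`-INDEPENDENT factor `(θ²)^{−n₁}`

Cell `pub-balaban-gaps` (YM blitz Y1, track G2, seat `ne7`, generation 14); text of record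
`run/shared/lean/pub/pub-balaban-gaps/ne/NE7.md` (census §7quindecies ∕ row R83 of this generation).  Fifty-seventh `Spine/NE7/` file;
0 `def`, 0 sorry; [folklore] finite-sum bookkeeping over `Spine.NE7.QLa` (file 2) and `T4RecentScale.Multiplicity`.

WHY.  NODE S's averaging-side certificates (files 25–33 ∕ 51–56) deliver the contracting rider-range bound
`s_X ≤ Cd·wt_X·θ^{2(K − sc X)}` only for entries whose (1.100)-type insert lies in the certificate's domain — in the level-free format
of files 55∕56: total variation `|Λ_X|·Dm_X ≤ min(τ⋆, τ⋆₂)`, `τ⋆ ≈ 2·10⁻⁹` at `(d, L) = (4, 3)` (generation 8's non-optimal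
second-order constants).  The printed inserts have one-bond deviations `O(1)M²NR_k⁴·ε_k` ([Balaban1989LargeFieldI] p. 196), i.e.
`C·L^{−age}` with a polylogarithmic `C ≫ τ⋆`: the condition FAILS for the youngest `n₁ ≈ log_L(C·|X|∕τ⋆)` ages of every component's
history (census R44 ∕ R46 ∕ §7quindecies: constant-vs-polylog, booked as row NE1′'s ∕ NODE 00's (β)).  For those entries the only
available bound is the TRIVIAL one: the rider `W − 1` has range `≤ 2` whatever the configuration, so
`|c_t(X) − c_0(X)| ≤ 2·|t|·2` (`QLaCriticality.abs_log_integral_exp_sub_le` with `s = 2`).  THIS FILE records, as a kernel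
statement, that the silence costs only a CONSTANT: if the contracting bound holds for the entries of age `≥ n₁`, the trivial bound for
all entries, the census `Multiplicity wf sc wt Cw vol Λ K` for the weights AND the plain count census
`Multiplicity wf sc 1 Cc vol Λ K` (the number of scale-`j` entries is `≤ Cc·vol·Λ^{K−j}` — print's (0.26) count of scale-`j`
localization domains per unit volume, [Balaban1987RG1] p. 257), then `Spine.NE7.QLa wf sc ct c0 K vol Ew (θ²Λ)` with
`Ew = 2l₀·Cd·Cw + 4l₀·Cc·(θ²)^{−n₁}` — the SAME geometric ratio `a = θ²Λ` (`= L⁻²` in d = 4), a size constant independent of `K`.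
So the summability mechanism of (QL-a) is insensitive to WHICH finite stretch of young ages the object node can certify, provided
`n₁` does not grow with `K` (in print the insert constant depends on the running coupling `g_k`, a function of the age `K − k` under
the unit-scale keying — census §7quindecies).

HONEST FRAMING.  Finite-sum algebra; the hypotheses are SHAPES (which entries satisfy the contracting bound, the two censuses) to be
discharged by NODE 00 Stage 5 on Bałaban's objects; nothing of Bałaban's asserted beyond print; (QL-a) NOT IN PRINT
([Balaban1989LargeFieldII] p. 356); NE7 NOT proved; spine 0∕9; one fixed finite T⁴ — NOT ℝ⁴, NOT infinite volume, NOT a mass gap, NOT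
Clay.  No classification word moves (R10).
-/

noncomputable section

open Finset
open scoped BigOperators

namespace Summit.QuantumFields.BalabanUV.T4Continuum.Spine.NE7

open Literature.MathematicalPhysics.QuantumFieldTheory.Balaban1983to89
open Literature.MathematicalPhysics.QuantumFieldTheory.Balaban1983to89.T4Continuum
open Literature.MathematicalPhysics.QuantumFieldTheory.Balaban1983to89.T4RecentScale (Multiplicity)

variable {D : Type*}

/-! ## §1 The scale slices: old entries by the weighted census, young entries by the count census -/

/-- OLD SLICE: if every entry of the scale-`j` slice obeys the contracting bound `|c_t − c_0| ≤ 2|t|·Cd·wt·(θ^{K−j})²`, the weighted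
census turns the slice sum into `vol·(2l₀CdCw)·(θ²Λ)^{K−j}`. [folklore] -/
theorem slice_le_of_defect {wf : Finset D} {sc : D → ℕ} {wt ct c0 : D → ℝ} {K j : ℕ} {l₀ Cd θ t Cw vol Λ : ℝ}
    (ht : |t| ≤ l₀) (hCd : 0 ≤ Cd) (hwt : ∀ X ∈ wf, 0 ≤ wt X) (hj : j ≤ K)
    (hdef : ∀ X ∈ wf, sc X = j → |ct X - c0 X| ≤ 2 * (|t| * (Cd * wt X * (θ ^ (K - sc X)) ^ 2)))
    (hM : Multiplicity wf sc wt Cw vol Λ K) :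
    ∑ X ∈ wf with sc X = j, |ct X - c0 X| ≤ vol * (2 * l₀ * Cd * Cw * (θ ^ 2 * Λ) ^ (K - j)) := by
  have hθ2 : 0 ≤ (θ ^ 2) ^ (K - j) := pow_nonneg (sq_nonneg θ) _
  have hcoef : 0 ≤ 2 * l₀ * Cd * (θ ^ 2) ^ (K - j) :=
    mul_nonneg (mul_nonneg (mul_nonneg zero_le_two ((abs_nonneg t).trans ht)) hCd) hθ2
  calc ∑ X ∈ wf with sc X = j, |ct X - c0 X|
      ≤ ∑ X ∈ wf with sc X = j, 2 * l₀ * Cd * (θ ^ 2) ^ (K - j) * wt X := sum_le_sum fun X hX => by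
          obtain ⟨hXw, hXj⟩ := mem_filter.mp hX
          have h := hdef X hXw hXj
          rw [hXj, ← pow_mul, mul_comm (K - j) 2, pow_mul] at h
          have hs : 0 ≤ Cd * wt X * (θ ^ 2) ^ (K - j) := mul_nonneg (mul_nonneg hCd (hwt X hXw)) hθ2
          calc |ct X - c0 X| ≤ 2 * (|t| * (Cd * wt X * (θ ^ 2) ^ (K - j))) := h
            _ ≤ 2 * (l₀ * (Cd * wt X * (θ ^ 2) ^ (K - j))) :=
                mul_le_mul_of_nonneg_left (mul_le_mul_of_nonneg_right ht hs) zero_le_two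
            _ = 2 * l₀ * Cd * (θ ^ 2) ^ (K - j) * wt X := by ring
    _ = 2 * l₀ * Cd * (θ ^ 2) ^ (K - j) * ∑ X ∈ wf with sc X = j, wt X := (mul_sum _ _ _).symm
    _ ≤ 2 * l₀ * Cd * (θ ^ 2) ^ (K - j) * (Cw * vol * Λ ^ (K - j)) := mul_le_mul_of_nonneg_left (hM j hj) hcoef
    _ = vol * (2 * l₀ * Cd * Cw * (θ ^ 2 * Λ) ^ (K - j)) := by rw [mul_pow]; ring

/-- YOUNG SLICE: with only the TRIVIAL bound `|c_t − c_0| ≤ 4|t|` on the scale-`j` slice and the COUNT census (`Multiplicity` with unit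
weights), the slice sum is `≤ vol·(4l₀Cc·(θ²)^{−(K−j)})·(θ²Λ)^{K−j}` — and `(θ²)^{−(K−j)} ≤ (θ²)^{−n₁}` when the age `K − j` is
`< n₁` and `0 < θ ≤ 1`. [folklore] -/
theorem slice_le_of_trivial {wf : Finset D} {sc : D → ℕ} {ct c0 : D → ℝ} {K j n₁ : ℕ} {l₀ θ t Cc vol Λ : ℝ}
    (ht : |t| ≤ l₀) (hj : j ≤ K) (hyoung : K - j < n₁) (hθ0 : 0 < θ) (hθ1 : θ ≤ 1) (hΛ : 0 ≤ Λ) (hvol : 0 ≤ vol) (hCc : 0 ≤ Cc)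
    (htriv : ∀ X ∈ wf, sc X = j → |ct X - c0 X| ≤ 4 * |t|)
    (hcount : Multiplicity wf sc (fun _ => (1 : ℝ)) Cc vol Λ K) :
    ∑ X ∈ wf with sc X = j, |ct X - c0 X| ≤ vol * (4 * l₀ * Cc * ((θ ^ 2)⁻¹) ^ n₁ * (θ ^ 2 * Λ) ^ (K - j)) := by
  have hl₀ : 0 ≤ l₀ := (abs_nonneg t).trans ht
  have hθ2 : 0 < θ ^ 2 := pow_pos hθ0 2
  have hθ21 : θ ^ 2 ≤ 1 := pow_le_one₀ hθ0.le hθ1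
  have hinv1 : 1 ≤ (θ ^ 2)⁻¹ := one_le_inv_iff₀.mpr ⟨hθ2, hθ21⟩
  -- the count of the slice
  have hcnt : (((wf.filter fun X => sc X = j).card : ℝ)) ≤ Cc * vol * Λ ^ (K - j) := by
    have h := hcount j hj
    rwa [sum_const, nsmul_eq_mul, mul_one] at h
  -- `(θ²)^{−(K−j)} ≤ (θ²)^{−n₁}`
  have hpow : ((θ ^ 2)⁻¹) ^ (K - j) ≤ ((θ ^ 2)⁻¹) ^ n₁ := pow_le_pow_right₀ hinv1 hyoung.le
  -- `Λ^{K−j} = (θ²)^{−(K−j)}·(θ²Λ)^{K−j}`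
  have hsplit : Λ ^ (K - j) = ((θ ^ 2)⁻¹) ^ (K - j) * (θ ^ 2 * Λ) ^ (K - j) := by
    rw [mul_pow, ← mul_assoc, ← mul_pow, inv_mul_cancel₀ hθ2.ne', one_pow, one_mul]
  calc ∑ X ∈ wf with sc X = j, |ct X - c0 X|
      ≤ ∑ X ∈ wf with sc X = j, 4 * l₀ := sum_le_sum fun X hX => by
          obtain ⟨hXw, hXj⟩ := mem_filter.mp hX
          exact (htriv X hXw hXj).trans (by nlinarith [abs_nonneg t])
    _ = ((wf.filter fun X => sc X = j).card : ℝ) * (4 * l₀) := by rw [sum_const, nsmul_eq_mul]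
    _ ≤ Cc * vol * Λ ^ (K - j) * (4 * l₀) := mul_le_mul_of_nonneg_right hcnt (by positivity)
    _ = 4 * l₀ * Cc * vol * (((θ ^ 2)⁻¹) ^ (K - j) * (θ ^ 2 * Λ) ^ (K - j)) := by rw [← hsplit]; ring
    _ ≤ 4 * l₀ * Cc * vol * (((θ ^ 2)⁻¹) ^ n₁ * (θ ^ 2 * Λ) ^ (K - j)) := by
        refine mul_le_mul_of_nonneg_left (mul_le_mul_of_nonneg_right hpow (pow_nonneg ?_ _)) (by positivity)
        exact mul_nonneg hθ2.le hΛ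
    _ = vol * (4 * l₀ * Cc * ((θ ^ 2)⁻¹) ^ n₁ * (θ ^ 2 * Λ) ^ (K - j)) := by ring

/-! ## §2 (QL-a) with the contracting bound only beyond a fixed age -/

/-- **(QL-a) WHEN NODE S IS SILENT ON THE YOUNGEST `n₁` AGES.**  A finite ledger `wf` with scales `sc ≤ K`, census weights `wt ≥ 0`,
the weighted census `Multiplicity wf sc wt Cw vol Λ K` AND the count census `Multiplicity wf sc 1 Cc vol Λ K`; per entry the TRIVIAL
bound `|c_t − c_0| ≤ 4|t|` (rider range `≤ 2`), and the CONTRACTING bound `|c_t − c_0| ≤ 2|t|·Cd·wt·(θ^{K − sc})²` for the entries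
of age `K − sc X ≥ n₁` only; `0 < θ ≤ 1`, `Λ, vol, Cw, Cc ≥ 0`.  Then for every `|t| ≤ l₀`:
`Spine.NE7.QLa wf sc ct c0 K vol (2l₀CdCw + 4l₀Cc·(θ²)^{−n₁}) (θ²·Λ)` — the same ratio as file 5's `qla_of_defect`, the size
constant inflated by the `K`-INDEPENDENT factor `(θ²)^{−n₁}`. [folklore] -/
theorem qla_of_defect_eventually {wf : Finset D} {sc : D → ℕ} {wt ct c0 : D → ℝ} {K n₁ : ℕ} {l₀ Cd θ t Cw Cc vol Λ : ℝ}
    (ht : |t| ≤ l₀) (hCd : 0 ≤ Cd) (hwt : ∀ X ∈ wf, 0 ≤ wt X) (hθ0 : 0 < θ) (hθ1 : θ ≤ 1) (hΛ : 0 ≤ Λ) (hvol : 0 ≤ vol)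
    (hCw : 0 ≤ Cw) (hCc : 0 ≤ Cc)
    (htriv : ∀ X ∈ wf, |ct X - c0 X| ≤ 4 * |t|)
    (hdef : ∀ X ∈ wf, n₁ ≤ K - sc X → |ct X - c0 X| ≤ 2 * (|t| * (Cd * wt X * (θ ^ (K - sc X)) ^ 2)))
    (hM : Multiplicity wf sc wt Cw vol Λ K) (hcount : Multiplicity wf sc (fun _ => (1 : ℝ)) Cc vol Λ K) :
    QLa wf sc ct c0 K vol (2 * l₀ * Cd * Cw + 4 * l₀ * Cc * ((θ ^ 2)⁻¹) ^ n₁) (θ ^ 2 * Λ) := by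
  intro j hj
  have hl₀ : 0 ≤ l₀ := (abs_nonneg t).trans ht
  have ha : 0 ≤ (θ ^ 2 * Λ) ^ (K - j) := pow_nonneg (mul_nonneg (sq_nonneg θ) hΛ) _
  have hθ2 : 0 < θ ^ 2 := pow_pos hθ0 2
  have hA : 0 ≤ 2 * l₀ * Cd * Cw * (θ ^ 2 * Λ) ^ (K - j) := by positivity
  have hB : 0 ≤ 4 * l₀ * Cc * ((θ ^ 2)⁻¹) ^ n₁ * (θ ^ 2 * Λ) ^ (K - j) := by positivity
  rcases Nat.lt_or_ge (K - j) n₁ with hyoung | hold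
  · -- young slice: trivial bound + count census
    have h := slice_le_of_trivial (wf := wf) (sc := sc) (ct := ct) (c0 := c0) ht hj hyoung hθ0 hθ1 hΛ hvol hCc
      (fun X hX _ => htriv X hX) hcount
    calc ∑ X ∈ wf with sc X = j, |ct X - c0 X| ≤ vol * (4 * l₀ * Cc * ((θ ^ 2)⁻¹) ^ n₁ * (θ ^ 2 * Λ) ^ (K - j)) := h
      _ ≤ vol * (2 * l₀ * Cd * Cw * (θ ^ 2 * Λ) ^ (K - j) + 4 * l₀ * Cc * ((θ ^ 2)⁻¹) ^ n₁ * (θ ^ 2 * Λ) ^ (K - j)) :=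
          mul_le_mul_of_nonneg_left (by linarith) hvol
      _ = vol * ((2 * l₀ * Cd * Cw + 4 * l₀ * Cc * ((θ ^ 2)⁻¹) ^ n₁) * (θ ^ 2 * Λ) ^ (K - j)) := by ring
  · -- old slice: contracting bound + weighted census
    have h := slice_le_of_defect (wf := wf) ht hCd hwt hj (fun X hX hXj => hdef X hX (by rw [hXj]; exact hold)) hM
    calc ∑ X ∈ wf with sc X = j, |ct X - c0 X| ≤ vol * (2 * l₀ * Cd * Cw * (θ ^ 2 * Λ) ^ (K - j)) := h
      _ ≤ vol * (2 * l₀ * Cd * Cw * (θ ^ 2 * Λ) ^ (K - j) + 4 * l₀ * Cc * ((θ ^ 2)⁻¹) ^ n₁ * (θ ^ 2 * Λ) ^ (K - j)) :=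
          mul_le_mul_of_nonneg_left (by linarith) hvol
      _ = vol * ((2 * l₀ * Cd * Cw + 4 * l₀ * Cc * ((θ ^ 2)⁻¹) ^ n₁) * (θ ^ 2 * Λ) ^ (K - j)) := by ring

/-- **THE TRIVIAL PER-ENTRY BOUND** in W-fmt@1: for ANY two probability laws and a rider `G` with `|G| ≤ 2` a.e. (the loop observable
`W − 1`, `|W| ≤ 1`), `|log∫e^{tG}dν₁ − log∫e^{tG}dν₂| ≤ 4|t|` — NODE S's currency for the entries it is silent on
(`abs_log_integral_exp_sub_le` with `s = 2`). [folklore] -/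
theorem abs_log_quotient_sub_le_trivial {Ω : Type*} [MeasurableSpace Ω] (ν₁ ν₂ : MeasureTheory.Measure Ω)
    [MeasureTheory.IsProbabilityMeasure ν₁] [MeasureTheory.IsProbabilityMeasure ν₂] {G : Ω → ℝ}
    (hG₁ : MeasureTheory.AEStronglyMeasurable G ν₁) (hG₂ : MeasureTheory.AEStronglyMeasurable G ν₂)
    (hb₁ : ∀ᵐ ω ∂ν₁, |G ω| ≤ 2) (hb₂ : ∀ᵐ ω ∂ν₂, |G ω| ≤ 2) (t : ℝ) :
    |Real.log (∫ ω, Real.exp (t * G ω) ∂ν₁) - Real.log (∫ ω, Real.exp (t * G ω) ∂ν₂)| ≤ 4 * |t| := by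
  have h := abs_log_integral_exp_sub_le ν₁ ν₂ hG₁ hG₂ hb₁ hb₂ t
  linarith

/-- The loop observable's rider has range `≤ 2`: `|W(U) − 1| ≤ 2` for every configuration (`|W| ≤ 1`, the tree's
`abs_loopAt_le_one`) — whatever the domain, so the trivial per-entry bound is always available. [folklore] -/
theorem abs_loopAt_sub_one_le_two {P : Params} {G : Type*} [GaugeGroup G] [MeasurableSpace G] [RegularGaugeGroup G] {j : ℕ}
    (U : GaugeField P j G) (γ : List (LStep P j)) : |loopAt U γ - 1| ≤ 2 := by
  have h := abs_loopAt_le_one U γ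
  rw [abs_le] at h ⊢
  constructor <;> linarith [h.1, h.2]

end Summit.QuantumFields.BalabanUV.T4Continuum.Spine.NE7

end
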